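import Summits.ValiantsHypothesis.ValiantsHypothesis.Theorems.LacunarySymmetroidMatrixDescartesFiniteSectorStampCeilingThreeEightA
import Summits.ValiantsHypothesis.ValiantsHypothesis.Theorems.LacunarySymmetroidMatrixDescartesFiniteSectorStampCeilingThreeEightB
import Summits.ValiantsHypothesis.ValiantsHypothesis.Theorems.LacunarySymmetroidMatrixDescartesFiniteSectorStampCeilingThreeEightC
import Summits.ValiantsHypothesis.ValiantsHypothesis.Theorems.LacunarySymmetroidMatrixDescartesFiniteSectorStampCeilingThreeEightD
import Summits.ValiantsHypothesis.ValiantsHypothesis.Theorems.LacunarySymmetroidMatrixDescartesFiniteSectorSumMasksHigher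

/-!
# `MatrixDescartes` — line «stamp»: the STAMP CEILING `ν(3,8) ≤ 70 = n(3,7)` (kernel) — `StampLawAt 3 8 70`

HONEST FRAMING.  Object-search cell `pub-symmetroid`, seat val-sym-door-p5 g8.  HELPER of the crux item `stmt-ValiantsHypothesis-18050` with NO closure claim.
T3 (`mem_sumset_of_fullPos`) makes every `r ≤ deg` of a full-positive-rooted symmetric `3 × 3` half-pencil with `8` terms an `3`-fold sum of exponents; the
values `0, 1` occur, and the capped, padded, sorted value set must cover `[0, deg]`; the finite core — no `7` denominations with `3` stamps cover `[0, 71]`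
(`n(3,7) = 70`) — has 125658 live prefixes and is decided in the kernel in SLICES by the third and fourth values `(a,b)` (`a ≤ 4`, `b ≤ 3a + 1` forced by
the cover at `4` and `3a + 1`; dead pairs in that range are refuted by `decide` on the prefix atom): slices in
`…FiniteSectorStampCeilingThreeEightA`, `…FiniteSectorStampCeilingThreeEightB`, `…FiniteSectorStampCeilingThreeEightC`, `…FiniteSectorStampCeilingThreeEightD` (this file holds the transfer only); `3`-fold sums as
iterated shift-form bitmasks.  Result: `stampLawAt_three_eight : StampLawAt 3 8 70`.  Located first (exact DFS, this seat): best reach of `7` denominations with `3`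
stamps = `70` (e.g. {1,4,5,15,18,27,34}).  Nothing here bears on the crux (asymptotic), on the doors, or on `VP ≠ VNP`.
[folklore] Postage-stamp bookkeeping on the proved T3 (Guy UPINT C12; Challis / Mossige tables); no citation is load-bearing.
-/

-- `Summit.ValiantsHypothesis.ValiantsHypothesis.…` repeats a component by the D-0017 layout
-- (single-conjunct summit), which the `dupNamespace` linter flags; the name is mandated.
set_option linter.dupNamespace false

namespace Summit.ValiantsHypothesis.ValiantsHypothesis.Theorems.LacunarySymmetroidMatrixDescartes.FiniteSector

open scoped BigOperators Matrix
open Polynomial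

/-! ## `(3,8)`: `ν(3,8) ≤ n(3,7) = 70` — the transfer -/

/-- **`ν(3,8) ≤ 70 = n(3,7)`** — `StampLawAt 3 8 70`: every full-positive-rooted symmetric `3 × 3` half-pencil determinant with `8` terms has
degree `≤ 70` (T3 ⇒ every `r ≤ deg` is an `3`-fold sum; values `0, 1` forced; capped at `72`, padded, sorted; `a ≤ 4`, `b ≤ 3a + 1`; bitmasks; the slice checks). [folklore] -/
theorem stampLawAt_three_eight : StampLawAt 3 8 70 := by
  intro d S hS hfull
  by_contra hdeg'
  have hdeg : 70 < (pencil d S).det.natDegree := not_le.mp hdeg'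
  have hq : (pencil d S).det ≠ 0 := by
    intro h0
    rw [h0] at hdeg
    simp at hdeg
  have hmem : ∀ r, r ≤ (pencil d S).det.natDegree → ∃ i j k : Fin 8, d i + d j + d k = r := by
    intro r hr
    have hm := mem_sumset_of_fullPos d S hq hfull hr
    rw [Finset.mem_image] at hm
    obtain ⟨s, -, hs⟩ := hm
    have hcard : Multiset.card (s : Multiset (Fin 8)) = 3 := s.2
    obtain ⟨i, j, k, hijk⟩ := Multiset.card_eq_three.mp hcard
    refine ⟨i, j, k, ?_⟩
    have hsum : ((s : Multiset (Fin 8)).map d).sum = d i + d j + d k := by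
      rw [hijk]
      simp [add_assoc]
    omega
  set cv : Fin 8 → ℕ := fun i => min (d i) 72 with hcv
  have hcvd : ∀ i, d i ≤ 71 → cv i = d i := fun i hi => by
    simp only [hcv]
    exact Nat.min_eq_left (by omega)
  have hcvle : ∀ i, cv i ≤ 72 := fun i => Nat.min_le_right _ _
  set V : Finset ℕ := Finset.univ.image cv with hV
  have hcvV : ∀ i, cv i ∈ V := fun i => Finset.mem_image_of_mem cv (Finset.mem_univ i)
  have h0V : 0 ∈ V := by
    obtain ⟨i, j, k, hh⟩ := hmem 0 (Nat.zero_le _)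
    have : cv i = 0 := by rw [hcvd i (by omega)]; omega
    exact this ▸ hcvV i
  have h1V : 1 ∈ V := by
    obtain ⟨i, j, k, hh⟩ := hmem 1 (by omega)
    have key : ∃ t : Fin 8, d t = 1 := by
      by_contra hne; simp only [not_exists] at hne; have := hne i; have := hne j; have := hne k; omega
    obtain ⟨t, ht⟩ := key
    have : cv t = 1 := by rw [hcvd t (by omega)]; omega
    exact this ▸ hcvV t
  have h1V' : 1 ∈ V.erase 0 := Finset.mem_erase.mpr ⟨by norm_num, h1V⟩
  set W : Finset ℕ := (V.erase 0).erase 1 with hW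
  have hWsub : W ⊆ ((Finset.range 73).erase 0).erase 1 := by
    intro u hu
    rw [hW, Finset.mem_erase, Finset.mem_erase] at hu
    obtain ⟨hu1, hu0, huV⟩ := hu
    rw [hV, Finset.mem_image] at huV
    obtain ⟨i, -, rfl⟩ := huV
    rw [Finset.mem_erase, Finset.mem_erase, Finset.mem_range]
    exact ⟨hu1, hu0, Nat.lt_succ_of_le (hcvle i)⟩
  have hWcard : W.card ≤ 6 := by
    have hVK : V.card ≤ 8 := by
      have := Finset.card_image_le (s := (Finset.univ : Finset (Fin 8))) (f := cv)
      simpa using this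
    have h1 : (V.erase 0).card + 1 = V.card := Finset.card_erase_add_one h0V
    have h2 : W.card + 1 = (V.erase 0).card := by rw [hW]; exact Finset.card_erase_add_one h1V'
    omega
  obtain ⟨W', hWW', hW'sub, hW'card⟩ := Finset.exists_subsuperset_card_eq hWsub hWcard (by
    rw [Finset.card_erase_of_mem (by simp), Finset.card_erase_of_mem (by simp), Finset.card_range]; omega)
  have hVW' : ∀ u ∈ V, u = 0 ∨ u = 1 ∨ u ∈ W' := by
    intro u hu
    by_cases hu0 : u = 0
    · exact Or.inl hu0
    by_cases hu1 : u = 1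
    · exact Or.inr (Or.inl hu1)
    · exact Or.inr (Or.inr (hWW' (by rw [hW, Finset.mem_erase, Finset.mem_erase]; exact ⟨hu1, hu0, hu⟩)))
  have hlmem : ∀ u, u ∈ Finset.sort W' ↔ u ∈ W' := fun u => Finset.mem_sort _
  have hlsort : (Finset.sort W').SortedLT := Finset.sortedLT_sort W'
  have hllen : (Finset.sort W').length = 6 := by rw [Finset.length_sort, hW'card]
  generalize hl : Finset.sort W' = l at hlmem hlsort hllen
  rcases l with _ | ⟨a, _ | ⟨b, _ | ⟨c, _ | ⟨e, _ | ⟨f, _ | ⟨g, _ | ⟨zz, ll⟩⟩⟩⟩⟩⟩⟩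
  all_goals simp only [List.length_cons, List.length_nil] at hllen
  all_goals try omega
  have hmemR : ∀ u, u ∈ [a, b, c, e, f, g] → u ∈ List.range 73 := by
    intro u hu
    have hu' : u ∈ W' := (hlmem u).mp hu
    have := hW'sub hu'
    rw [Finset.mem_erase, Finset.mem_erase, Finset.mem_range] at this
    exact List.mem_range.mpr this.2.2
  have hgt1 : ∀ u, u ∈ [a, b, c, e, f, g] → 1 < u := by
    intro u hu
    have hu' : u ∈ W' := (hlmem u).mp hu
    have := hW'sub hu'
    rw [Finset.mem_erase, Finset.mem_erase] at this
    omega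
  have h1a : 1 < a := hgt1 a (by simp)
  have hmemP : ∀ r, r ≤ 71 → (∃ i j k : Fin 8, d i + d j + d k = r) → (∃ x ∈ [0, 1, a, b, c, e, f, g], ∃ y ∈ [0, 1, a, b, c, e, f, g], ∃ z ∈ [0, 1, a, b, c, e, f, g], x + y + z = r) := by
    rintro r hr ⟨i, j, k, hsum⟩
    have hi : cv i = d i := hcvd i (by omega)
    have hj : cv j = d j := hcvd j (by omega)
    have hk : cv k = d k := hcvd k (by omega)
    have hin : ∀ u ∈ V, u ∈ [0, 1, a, b, c, e, f, g] := by
      intro u hu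
      rcases hVW' u hu with h | h | h
      · rw [h]; simp
      · rw [h]; simp
      · exact List.mem_cons_of_mem _ (List.mem_cons_of_mem _ ((hlmem u).mpr h))
    exact ⟨cv i, hin _ (hcvV i), cv j, hin _ (hcvV j), cv k, hin _ (hcvV k), by rw [hi, hj, hk]; exact hsum⟩
  have hcovP : ∀ r, r ≤ 71 → (∃ x ∈ [0, 1, a, b, c, e, f, g], ∃ y ∈ [0, 1, a, b, c, e, f, g], ∃ z ∈ [0, 1, a, b, c, e, f, g], x + y + z = r) := fun r hr => hmemP r hr (hmem r (by omega))
  have hlt1 : a < b := by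
    have := hlsort (show (⟨0, by simp⟩ : Fin [a, b, c, e, f, g].length) < ⟨1, by simp⟩ from Fin.mk_lt_mk.mpr (by norm_num))
    simpa using this
  have hlt2 : b < c := by
    have := hlsort (show (⟨1, by simp⟩ : Fin [a, b, c, e, f, g].length) < ⟨2, by simp⟩ from Fin.mk_lt_mk.mpr (by norm_num))
    simpa using this
  have hlt3 : c < e := by
    have := hlsort (show (⟨2, by simp⟩ : Fin [a, b, c, e, f, g].length) < ⟨3, by simp⟩ from Fin.mk_lt_mk.mpr (by norm_num))
    simpa using this
  have hlt4 : e < f := by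
    have := hlsort (show (⟨3, by simp⟩ : Fin [a, b, c, e, f, g].length) < ⟨4, by simp⟩ from Fin.mk_lt_mk.mpr (by norm_num))
    simpa using this
  have hlt5 : f < g := by
    have := hlsort (show (⟨4, by simp⟩ : Fin [a, b, c, e, f, g].length) < ⟨5, by simp⟩ from Fin.mk_lt_mk.mpr (by norm_num))
    simpa using this
  -- bounds on the third and fourth values: `a ≤ 4` (cover at `4`), `b ≤ 3a + 1` (cover at `3a + 1`)
  have hrestA : ∀ y ∈ [a, b, c, e, f, g], a ≤ y := by
    intro y hy
    simp only [List.mem_cons, List.mem_nil_iff, or_false] at hy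
    omega
  have hrestB : ∀ y ∈ [b, c, e, f, g], b ≤ y := by
    intro y hy
    simp only [List.mem_cons, List.mem_nil_iff, or_false] at hy
    omega
  have haM : a ≤ 4 := by
    by_contra hh
    obtain ⟨x, hx, y, hy, z, hz, hsum⟩ := memP3_prefix (l₁ := [0, 1]) (l₂ := [a, b, c, e, f, g]) hrestA (show 4 < a by omega) (hcovP 4 (by omega))
    simp only [List.mem_cons, List.mem_nil_iff, or_false] at hx hy hz
    omega
  have hbM : b ≤ 3 * a + 1 := by
    by_contra hh
    obtain ⟨x, hx, y, hy, z, hz, hsum⟩ := memP3_prefix (l₁ := [0, 1, a]) (l₂ := [b, c, e, f, g]) hrestB (show 3 * a + 1 < b by omega) (hcovP (3 * a + 1) (by omega))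
    simp only [List.mem_cons, List.mem_nil_iff, or_false] at hx hy hz
    rcases hx with rfl | rfl | rfl <;> rcases hy with rfl | rfl | rfl <;> rcases hz with rfl | rfl | rfl <;> omega
  have pre2 : (List.foldr (fun x acc => acc ||| (List.foldr (fun x acc => acc ||| (List.foldr (fun y acc => acc ||| 2 ^ y) 0 [0, 1, a]) * 2 ^ x) 0 [0, 1, a]) * 2 ^ x) 0 [0, 1, a] % 2 ^ (min 72 b) = 2 ^ (min 72 b) - 1) := by
    apply maskFull_of_testBit
    intro r hr
    have hrN : r < 72 := lt_of_lt_of_le hr (min_le_left _ _)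
    have hrv : r < b := lt_of_lt_of_le hr (min_le_right _ _)
    have hrest : ∀ y ∈ [b, c, e, f, g], b ≤ y := by
      intro y hy
      simp only [List.mem_cons, List.mem_nil_iff, or_false] at hy
      omega
    exact testBit_fold3Shift_of_mem (memP3_prefix (l₁ := [0, 1, a]) (l₂ := [b, c, e, f, g]) hrest hrv (hcovP r (by omega)))
  have pre3 : (List.foldr (fun x acc => acc ||| (List.foldr (fun x acc => acc ||| (List.foldr (fun y acc => acc ||| 2 ^ y) 0 [0, 1, a, b]) * 2 ^ x) 0 [0, 1, a, b]) * 2 ^ x) 0 [0, 1, a, b] % 2 ^ (min 72 c) = 2 ^ (min 72 c) - 1) := by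
    apply maskFull_of_testBit
    intro r hr
    have hrN : r < 72 := lt_of_lt_of_le hr (min_le_left _ _)
    have hrv : r < c := lt_of_lt_of_le hr (min_le_right _ _)
    have hrest : ∀ y ∈ [c, e, f, g], c ≤ y := by
      intro y hy
      simp only [List.mem_cons, List.mem_nil_iff, or_false] at hy
      omega
    exact testBit_fold3Shift_of_mem (memP3_prefix (l₁ := [0, 1, a, b]) (l₂ := [c, e, f, g]) hrest hrv (hcovP r (by omega)))
  have pre4 : (List.foldr (fun x acc => acc ||| (List.foldr (fun x acc => acc ||| (List.foldr (fun y acc => acc ||| 2 ^ y) 0 [0, 1, a, b, c]) * 2 ^ x) 0 [0, 1, a, b, c]) * 2 ^ x) 0 [0, 1, a, b, c] % 2 ^ (min 72 e) = 2 ^ (min 72 e) - 1) := by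
    apply maskFull_of_testBit
    intro r hr
    have hrN : r < 72 := lt_of_lt_of_le hr (min_le_left _ _)
    have hrv : r < e := lt_of_lt_of_le hr (min_le_right _ _)
    have hrest : ∀ y ∈ [e, f, g], e ≤ y := by
      intro y hy
      simp only [List.mem_cons, List.mem_nil_iff, or_false] at hy
      omega
    exact testBit_fold3Shift_of_mem (memP3_prefix (l₁ := [0, 1, a, b, c]) (l₂ := [e, f, g]) hrest hrv (hcovP r (by omega)))
  have pre5 : (List.foldr (fun x acc => acc ||| (List.foldr (fun x acc => acc ||| (List.foldr (fun y acc => acc ||| 2 ^ y) 0 [0, 1, a, b, c, e]) * 2 ^ x) 0 [0, 1, a, b, c, e]) * 2 ^ x) 0 [0, 1, a, b, c, e] % 2 ^ (min 72 f) = 2 ^ (min 72 f) - 1) := by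
    apply maskFull_of_testBit
    intro r hr
    have hrN : r < 72 := lt_of_lt_of_le hr (min_le_left _ _)
    have hrv : r < f := lt_of_lt_of_le hr (min_le_right _ _)
    have hrest : ∀ y ∈ [f, g], f ≤ y := by
      intro y hy
      simp only [List.mem_cons, List.mem_nil_iff, or_false] at hy
      omega
    exact testBit_fold3Shift_of_mem (memP3_prefix (l₁ := [0, 1, a, b, c, e]) (l₂ := [f, g]) hrest hrv (hcovP r (by omega)))
  have pre6 : (List.foldr (fun x acc => acc ||| (List.foldr (fun x acc => acc ||| (List.foldr (fun y acc => acc ||| 2 ^ y) 0 [0, 1, a, b, c, e, f]) * 2 ^ x) 0 [0, 1, a, b, c, e, f]) * 2 ^ x) 0 [0, 1, a, b, c, e, f] % 2 ^ (min 72 g) = 2 ^ (min 72 g) - 1) := by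
    apply maskFull_of_testBit
    intro r hr
    have hrN : r < 72 := lt_of_lt_of_le hr (min_le_left _ _)
    have hrv : r < g := lt_of_lt_of_le hr (min_le_right _ _)
    have hrest : ∀ y ∈ [g], g ≤ y := by
      intro y hy
      simp only [List.mem_cons, List.mem_nil_iff, or_false] at hy
      omega
    exact testBit_fold3Shift_of_mem (memP3_prefix (l₁ := [0, 1, a, b, c, e, f]) (l₂ := [g]) hrest hrv (hcovP r (by omega)))
  have hcovT : (List.foldr (fun x acc => acc ||| (List.foldr (fun x acc => acc ||| (List.foldr (fun y acc => acc ||| 2 ^ y) 0 [0, 1, a, b, c, e, f, g]) * 2 ^ x) 0 [0, 1, a, b, c, e, f, g]) * 2 ^ x) 0 [0, 1, a, b, c, e, f, g] % 2 ^ 72 = 2 ^ 72 - 1) :=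
    maskFull_of_testBit (fun r hr => testBit_fold3Shift_of_mem (hcovP r (by omega)))
  interval_cases a <;> interval_cases b
  · exact stampCheck_three_eight_s2_3 c (hmemR c (by simp)) ⟨hlt2, pre3⟩ e (hmemR e (by simp)) ⟨hlt3, pre4⟩ f (hmemR f (by simp)) ⟨hlt4, pre5⟩ g (hmemR g (by simp)) ⟨hlt5, pre6⟩ hcovT
  · exact stampCheck_three_eight_s2_4 c (hmemR c (by simp)) ⟨hlt2, pre3⟩ e (hmemR e (by simp)) ⟨hlt3, pre4⟩ f (hmemR f (by simp)) ⟨hlt4, pre5⟩ g (hmemR g (by simp)) ⟨hlt5, pre6⟩ hcovT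
  · exact stampCheck_three_eight_s2_5 c (hmemR c (by simp)) ⟨hlt2, pre3⟩ e (hmemR e (by simp)) ⟨hlt3, pre4⟩ f (hmemR f (by simp)) ⟨hlt4, pre5⟩ g (hmemR g (by simp)) ⟨hlt5, pre6⟩ hcovT
  · exact stampCheck_three_eight_s2_6 c (hmemR c (by simp)) ⟨hlt2, pre3⟩ e (hmemR e (by simp)) ⟨hlt3, pre4⟩ f (hmemR f (by simp)) ⟨hlt4, pre5⟩ g (hmemR g (by simp)) ⟨hlt5, pre6⟩ hcovT
  · exact stampCheck_three_eight_s2_7 c (hmemR c (by simp)) ⟨hlt2, pre3⟩ e (hmemR e (by simp)) ⟨hlt3, pre4⟩ f (hmemR f (by simp)) ⟨hlt4, pre5⟩ g (hmemR g (by simp)) ⟨hlt5, pre6⟩ hcovT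
  · exact stampCheck_three_eight_s3_4 c (hmemR c (by simp)) ⟨hlt2, pre3⟩ e (hmemR e (by simp)) ⟨hlt3, pre4⟩ f (hmemR f (by simp)) ⟨hlt4, pre5⟩ g (hmemR g (by simp)) ⟨hlt5, pre6⟩ hcovT
  · exact stampCheck_three_eight_s3_5 c (hmemR c (by simp)) ⟨hlt2, pre3⟩ e (hmemR e (by simp)) ⟨hlt3, pre4⟩ f (hmemR f (by simp)) ⟨hlt4, pre5⟩ g (hmemR g (by simp)) ⟨hlt5, pre6⟩ hcovT
  · exact stampCheck_three_eight_s3_6 c (hmemR c (by simp)) ⟨hlt2, pre3⟩ e (hmemR e (by simp)) ⟨hlt3, pre4⟩ f (hmemR f (by simp)) ⟨hlt4, pre5⟩ g (hmemR g (by simp)) ⟨hlt5, pre6⟩ hcovT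
  · exact stampCheck_three_eight_s3_7 c (hmemR c (by simp)) ⟨hlt2, pre3⟩ e (hmemR e (by simp)) ⟨hlt3, pre4⟩ f (hmemR f (by simp)) ⟨hlt4, pre5⟩ g (hmemR g (by simp)) ⟨hlt5, pre6⟩ hcovT
  · exact stampCheck_three_eight_s3_8 c (hmemR c (by simp)) ⟨hlt2, pre3⟩ e (hmemR e (by simp)) ⟨hlt3, pre4⟩ f (hmemR f (by simp)) ⟨hlt4, pre5⟩ g (hmemR g (by simp)) ⟨hlt5, pre6⟩ hcovT
  · exact absurd pre2 (by decide)
  · exact absurd pre2 (by decide)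
  · exact stampCheck_three_eight_s4_5 c (hmemR c (by simp)) ⟨hlt2, pre3⟩ e (hmemR e (by simp)) ⟨hlt3, pre4⟩ f (hmemR f (by simp)) ⟨hlt4, pre5⟩ g (hmemR g (by simp)) ⟨hlt5, pre6⟩ hcovT
  · exact stampCheck_three_eight_s4_6 c (hmemR c (by simp)) ⟨hlt2, pre3⟩ e (hmemR e (by simp)) ⟨hlt3, pre4⟩ f (hmemR f (by simp)) ⟨hlt4, pre5⟩ g (hmemR g (by simp)) ⟨hlt5, pre6⟩ hcovT
  · exact stampCheck_three_eight_s4_7 c (hmemR c (by simp)) ⟨hlt2, pre3⟩ e (hmemR e (by simp)) ⟨hlt3, pre4⟩ f (hmemR f (by simp)) ⟨hlt4, pre5⟩ g (hmemR g (by simp)) ⟨hlt5, pre6⟩ hcovT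
  · exact absurd pre2 (by decide)
  · exact absurd pre2 (by decide)
  · exact absurd pre2 (by decide)
  · exact absurd pre2 (by decide)
  · exact absurd pre2 (by decide)
  · exact absurd pre2 (by decide)

end Summit.ValiantsHypothesis.ValiantsHypothesis.Theorems.LacunarySymmetroidMatrixDescartes.FiniteSector
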